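import Summits.Ventures.PercRepro.C026CutVertexB2

/-!
# mine-3's Theorem B (B5): `c` a cut vertex separating `a` from `b` — (CF) holds (p5, gen 15)

mine-3 (`proofs/MINE3-BLOCKS.md` §1 (B5), §2): if the mark `c` is a cut vertex with `a` on one side and `b` on
the other, then with `α = #{a ~ c, a ∉ D}`, `α′ = #{a ~ c}`, `ᾱ = #{a ≁ c}` on the `a`-side and `β, β′, β̄` on
the `b`-side, `Δ_CF = α′β̄ + ᾱβ′ − αβ` (`slackCF_cut_c`); since `α ≤ α′` and `β ≤ β̄` (complement symmetry),
`Δ_CF ≥ ᾱβ′ ≥ 0`: **C-026 holds on every marked multigraph in which `c` separates `a` from `b`**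
(`slackCF_nonneg_of_cut_c`). Here `c` is the cut vertex of the two-colouring (`IsGluing c c c side`), `a` on
side `true`, `b` on side `false`.
-/

namespace PercRepro

open Finset

namespace MultiGraph

section CutVertexB5

variable {V E : Type*} {G : MultiGraph V E}

open Classical in
/-- **Theorem B (B5), the identity**: `Δ_CF(G) = α′β̄ + ᾱβ′ − αβ` when `c` separates `a` (side `true`) from `b`
(side `false`). -/
theorem slackCF_cut_c [Fintype E] {side : E → Bool} {a b c : V} (hg : G.IsGluing c c c side)
    (ha : G.OnSide side true a) (hb : G.OnSide side false b) (hab : a ≠ b) :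
    G.slackCF a b c =
      ((univ.filter fun ω₁ : Config {e // side e = true} => (G.part side true).Conn ω₁ c a).card : ℤ) *
          ((univ.filter fun ω₂ : Config {e // side e = false} =>
            ¬ (G.part side false).Conn ω₂ c b).card : ℤ) +
        ((univ.filter fun ω₁ : Config {e // side e = true} =>
            ¬ (G.part side true).Conn ω₁ c a).card : ℤ) *
          ((univ.filter fun ω₂ : Config {e // side e = false} => (G.part side false).Conn ω₂ c b).card : ℤ) -
        ((univ.filter fun ω₁ : Config {e // side e = true} =>
            (G.part side true).Conn ω₁ c a ∧ ¬ (G.part side true).Conn ω₁ᶜ c a).card : ℤ) *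
          ((univ.filter fun ω₂ : Config {e // side e = false} =>
            (G.part side false).Conn ω₂ c b ∧ ¬ (G.part side false).Conn ω₂ᶜ c b).card : ℤ) := by
  have htf : true ≠ false := by decide
  have hft : false ≠ true := by decide
  -- the dictionary at the marks (`c` is the cut vertex)
  have dac : ∀ ω : Config E, G.Conn ω c a ↔ (G.part side true).Conn (sideRestrict ω side true) c a :=
    fun ω => conn_cut_iff_same hg htf (Or.inl rfl) (Or.inr ha) ω
  have dcb : ∀ ω : Config E, G.Conn ω c b ↔ (G.part side false).Conn (sideRestrict ω side false) c b :=
    fun ω => conn_cut_iff_same hg hft (Or.inl rfl) (Or.inr hb) ω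
  have dab : ∀ ω : Config E, G.Conn ω a b ↔
      (G.part side true).Conn (sideRestrict ω side true) a c ∧
        (G.part side false).Conn (sideRestrict ω side false) c b :=
    fun ω => conn_cut_iff_cross hg htf (Or.inr ha) hb hab ω
  -- the cells of `G` as product events
  have h_ab : (univ.filter fun ω : Config E => G.Conn ω a b ∧ ¬ G.Conn ω a c).card = 0 := by
    rw [Finset.card_eq_zero, Finset.filter_eq_empty_iff]
    intro ω _ h
    exact h.2 ((dac ω).mpr ((dab ω).mp h.1).1.symm).symm
  have h_ac : (univ.filter fun ω : Config E => G.Conn ω c a ∧ ¬ G.Conn ω c b).card =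
      (univ.filter fun ω₁ : Config {e // side e = true} => (G.part side true).Conn ω₁ c a).card *
        (univ.filter fun ω₂ : Config {e // side e = false} =>
          ¬ (G.part side false).Conn ω₂ c b).card := by
    have e1 : (univ.filter fun ω : Config E => G.Conn ω c a ∧ ¬ G.Conn ω c b) =
        (univ.filter fun ω : Config E => (G.part side true).Conn (sideRestrict ω side true) c a ∧
          ¬ (G.part side false).Conn (sideRestrict ω side false) c b) :=
      Finset.filter_congr fun ω _ => by rw [dac, dcb]
    rw [e1]
    convert card_filter_cut side
      (fun ω₁ : Config {e // side e = true} => (G.part side true).Conn ω₁ c a)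
      (fun ω₂ : Config {e // side e = false} => ¬ (G.part side false).Conn ω₂ c b) using 4
  have h_bc : (univ.filter fun ω : Config E => G.Conn ω c b ∧ ¬ G.Conn ω c a).card =
      (univ.filter fun ω₁ : Config {e // side e = true} => ¬ (G.part side true).Conn ω₁ c a).card *
        (univ.filter fun ω₂ : Config {e // side e = false} => (G.part side false).Conn ω₂ c b).card := by
    have e1 : (univ.filter fun ω : Config E => G.Conn ω c b ∧ ¬ G.Conn ω c a) =
        (univ.filter fun ω : Config E => ¬ (G.part side true).Conn (sideRestrict ω side true) c a ∧
          (G.part side false).Conn (sideRestrict ω side false) c b) :=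
      Finset.filter_congr fun ω _ => by rw [dac, dcb]; tauto
    rw [e1]
    convert card_filter_cut side
      (fun ω₁ : Config {e // side e = true} => ¬ (G.part side true).Conn ω₁ c a)
      (fun ω₂ : Config {e // side e = false} => (G.part side false).Conn ω₂ c b) using 4
  have h_N : (univ.filter fun ω : Config E =>
      G.Conn ω a b ∧ ¬ G.Conn ωᶜ c a ∧ ¬ G.Conn ωᶜ c b).card =
      (univ.filter fun ω₁ : Config {e // side e = true} =>
          (G.part side true).Conn ω₁ c a ∧ ¬ (G.part side true).Conn ω₁ᶜ c a).card *
        (univ.filter fun ω₂ : Config {e // side e = false} =>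
          (G.part side false).Conn ω₂ c b ∧ ¬ (G.part side false).Conn ω₂ᶜ c b).card := by
    have e1 : (univ.filter fun ω : Config E => G.Conn ω a b ∧ ¬ G.Conn ωᶜ c a ∧ ¬ G.Conn ωᶜ c b) =
        (univ.filter fun ω : Config E =>
          ((G.part side true).Conn (sideRestrict ω side true) c a ∧
            ¬ (G.part side true).Conn (sideRestrict ω side true)ᶜ c a) ∧
          ((G.part side false).Conn (sideRestrict ω side false) c b ∧
            ¬ (G.part side false).Conn (sideRestrict ω side false)ᶜ c b)) :=
      Finset.filter_congr fun ω _ => by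
        rw [dab, dac, dcb, sideRestrict_compl, sideRestrict_compl]
        constructor
        · rintro ⟨⟨h1, h2⟩, h3, h4⟩
          exact ⟨⟨h1.symm, h3⟩, h2, h4⟩
        · rintro ⟨⟨h1, h3⟩, h2, h4⟩
          exact ⟨⟨h1.symm, h2⟩, h3, h4⟩
    rw [e1]
    convert card_filter_cut side
      (fun ω₁ : Config {e // side e = true} =>
        (G.part side true).Conn ω₁ c a ∧ ¬ (G.part side true).Conn ω₁ᶜ c a)
      (fun ω₂ : Config {e // side e = false} =>
        (G.part side false).Conn ω₂ c b ∧ ¬ (G.part side false).Conn ω₂ᶜ c b) using 4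
  unfold slackCF
  rw [h_ab, h_ac, h_bc, h_N]
  push_cast
  ring

open Classical in
/-- A closed-open count is at most the complementary count: `#{x ~ y, x ≁̄ y} ≤ #{x ≁ y}` (complement
symmetry). -/
theorem card_conn_not_compl_le {E' : Type*} [Fintype E'] (G' : MultiGraph V E') (x y : V) :
    (univ.filter fun ω : Config E' => G'.Conn ω x y ∧ ¬ G'.Conn ωᶜ x y).card ≤
      (univ.filter fun ω : Config E' => ¬ G'.Conn ω x y).card := by
  calc (univ.filter fun ω : Config E' => G'.Conn ω x y ∧ ¬ G'.Conn ωᶜ x y).card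
      ≤ (univ.filter fun ω : Config E' => ¬ G'.Conn ωᶜ x y).card := by
        apply Finset.card_le_card
        intro ω hω
        simp only [Finset.mem_filter, Finset.mem_univ, true_and] at hω ⊢
        exact hω.2
    _ = (univ.filter fun ω : Config E' => ¬ G'.Conn ω x y).card := by
        convert card_filter_compl_config (fun ω : Config E' => ¬ G'.Conn ω x y) using 4

open Classical in
/-- **Theorem B (B5)**: **C-026 holds on every marked multigraph in which `c` is a cut vertex separating `a`
from `b`**: `Δ_CF = α′β̄ + ᾱβ′ − αβ ≥ ᾱβ′ ≥ 0`. -/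
theorem slackCF_nonneg_of_cut_c [Fintype E] {side : E → Bool} {a b c : V} (hg : G.IsGluing c c c side)
    (ha : G.OnSide side true a) (hb : G.OnSide side false b) (hab : a ≠ b) :
    0 ≤ G.slackCF a b c := by
  rw [slackCF_cut_c hg ha hb hab]
  -- `α ≤ α′` (a subset) and `β ≤ β̄` (complement symmetry)
  have hα : (univ.filter fun ω₁ : Config {e // side e = true} =>
      (G.part side true).Conn ω₁ c a ∧ ¬ (G.part side true).Conn ω₁ᶜ c a).card ≤
      (univ.filter fun ω₁ : Config {e // side e = true} => (G.part side true).Conn ω₁ c a).card := by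
    apply Finset.card_le_card
    intro ω hω
    simp only [Finset.mem_filter, Finset.mem_univ, true_and] at hω ⊢
    exact hω.1
  have hβ : (univ.filter fun ω₂ : Config {e // side e = false} =>
      (G.part side false).Conn ω₂ c b ∧ ¬ (G.part side false).Conn ω₂ᶜ c b).card ≤
      (univ.filter fun ω₂ : Config {e // side e = false} => ¬ (G.part side false).Conn ω₂ c b).card := by
    convert card_conn_not_compl_le (G.part side false) c b using 4
  have h1 := Nat.mul_le_mul hα hβ
  nlinarith [Nat.cast_nonneg (α := ℤ) (univ.filter fun ω₁ : Config {e // side e = true} =>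
      ¬ (G.part side true).Conn ω₁ c a).card,
    Nat.cast_nonneg (α := ℤ) (univ.filter fun ω₂ : Config {e // side e = false} =>
      (G.part side false).Conn ω₂ c b).card]

end CutVertexB5

end MultiGraph

end PercRepro
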